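import Mathlib.Analysis.Normed.Lp.ProdLp
import Literature.Geometry.MetricGeometry.Submetry
import HarnessLib

/-!
# Isometries of an `ℓ²`-product `E ×₂ Y` with a bounded factor split

"Note that `H` acts separately on the two factors of `ℝˢ × Ŷ`, that is, each `h ∈ H` has the form
`(h₁, h₂)`, where `h₁ ∈ Isom(ℝˢ)`, `h₂ ∈ Isom(Ŷ)`. Let `Π₁ : Isom(ℝˢ × Ŷ) → Isom(ℝˢ)`,
`Π₂ : Isom(ℝˢ × Ŷ) → Isom(Ŷ)` be the projection maps …" — Huang–Huang–Wang–Zhu 2026, §4 p. 13, in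
the printed proof of their Main Theorem 1 (vendored as
`Literature.Geometry.Riemannian.huangHuangWangZhu2026_fibresOverCircle_four`), where `ℝˢ × Ŷ` is a
Gromov–Hausdorff limit carrying the `ℓ²`-product metric and `Ŷ` is COMPACT ("by the Cheeger–Gromoll
trick, one can prove that `Ŷ` is also compact"). This file proves that sentence as a theorem of
metric geometry, in the following generality: `E`, `E'` real normed spaces, `Y`, `Y'` bounded metric
spaces, and `h : E ×₂ Y ≃ᵢ E' ×₂ Y'` an isometric equivalence of the `ℓ²`-products
(`WithLp 2 (E × Y)`); then `h = A × B` for isometric equivalences `A : E ≃ᵢ E'`, `B : Y ≃ᵢ Y'`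
(`apply_toLp`), and for `E' = E`, `Y' = Y` the projections `Π₁ = fstComponentHom`,
`Π₂ = sndComponentHom` are group homomorphisms `Isom(E ×₂ Y) → Isom(E)`, `Isom(E ×₂ Y) → Isom(Y)`
which are jointly injective (`ext_of_components`) and jointly surjective (`prodCongrL2`).

The proof is elementary and does not use strict convexity of `E`:
§2 LINES ARE HORIZONTAL: an isometric embedding `γ : ℝ → α ×₂ β` into an `ℓ²`-product whose second
factor has diameter `≤ D` has unit-speed first component and motionless second component — if
`a = d(γ(s)₁, γ(t)₁) < L = t - s`, comparing the chain `γ(s-T), γ(s), γ(t), γ(t+T)` with the bound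
`d(γ(s-T)₁, γ(t+T)₁)² ≥ (L+2T)² - D²` gives `4T(L-a) ≤ D²` for every `T > 0`, absurd.
§3 Hence an isometry INTO a product with bounded metric second factor has second component
independent of the `E`-coordinate (join `v`, `v'` by a line).
§4 For an isometric EQUIVALENCE both `h` and `h⁻¹` have this property, so the second components
`B_h`, `B_{h⁻¹}` are mutually inverse distance-non-increasing maps, hence isometries; the `ℓ²`
Pythagoras identity then forces the first component to be independent of the `Y`-coordinate.

Mathlib has the `ℓ²`-product of (pseudo)metric spaces (`WithLp.instProdPseudoMetricSpace`) but no
result on its isometry group. Everything here is a definition with body or a proved theorem; no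
named facts.

## References

* H. Huang, X.-T. Huang, J. Wang, X. Zhu, arXiv:2605.24380 (2026), §4 p. 13. [HuangHuangWangZhu2026]
* (Context) J. Cheeger, D. Gromoll, *The splitting theorem for manifolds of nonnegative Ricci
  curvature*, J. Differential Geom. 6 (1971) 119–128 (isometries preserve the Euclidean factor of
  `ℝᵏ × Y` when `Y` contains no line); here only the bounded-`Y` case is treated.
-/

noncomputable section

open WithLp Metric Set

open scoped ENNReal

namespace Literature.Geometry.MetricGeometry

/-! ### §1. The `ℓ²`-product distance on `WithLp 2 (α × β)` for (pseudo)metric factors -/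

section DistSq

variable {α β : Type*} [PseudoMetricSpace α] [PseudoMetricSpace β]

/-- Pythagoras for the `ℓ²`-product of pseudometric spaces:
`d(x, y)² = d(x₁, y₁)² + d(x₂, y₂)²`. (Mathlib's `WithLp.prod_dist_eq_of_L2` is stated for
seminormed groups only; this is the metric-space form, from `WithLp.prod_dist_eq_add`.) [folklore] -/
theorem prodL2_dist_sq (x y : WithLp 2 (α × β)) :
    dist x y ^ 2 = dist x.fst y.fst ^ 2 + dist x.snd y.snd ^ 2 := by
  rw [prod_dist_eq_add (by norm_num : 0 < (2 : ℝ≥0∞).toReal) x y, ENNReal.toReal_ofNat,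
    Real.rpow_two, Real.rpow_two, ← Real.sqrt_eq_rpow, Real.sq_sqrt (by positivity)]

/-- Pythagoras on explicit pairs. [folklore] -/
theorem prodL2_dist_toLp_sq (a a' : α) (b b' : β) :
    dist (toLp 2 (a, b)) (toLp 2 (a', b')) ^ 2 = dist a a' ^ 2 + dist b b' ^ 2 := by
  rw [prodL2_dist_sq, toLp_fst, toLp_fst, toLp_snd, toLp_snd]

omit [PseudoMetricSpace α] [PseudoMetricSpace β] in
/-- A point of the product is the pair of its components. [folklore] -/
theorem toLp_fst_snd (x : WithLp 2 (α × β)) : toLp 2 (x.fst, x.snd) = x :=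
  rfl

/-- Horizontal slices are isometric copies of the first factor:
`d((a, b), (a', b)) = d(a, a')`. [folklore] -/
theorem prodL2_dist_toLp_left (a a' : α) (b : β) :
    dist (toLp 2 (a, b)) (toLp 2 (a', b)) = dist a a' := by
  have h := prodL2_dist_toLp_sq a a' b b
  rw [dist_self, zero_pow two_ne_zero, add_zero] at h
  exact (pow_left_inj₀ dist_nonneg dist_nonneg two_ne_zero).mp h

/-- Vertical slices are isometric copies of the second factor:
`d((a, b), (a, b')) = d(b, b')`. [folklore] -/
theorem prodL2_dist_toLp_right (a : α) (b b' : β) :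
    dist (toLp 2 (a, b)) (toLp 2 (a, b')) = dist b b' := by
  have h := prodL2_dist_toLp_sq a a b b'
  rw [dist_self, zero_pow two_ne_zero, zero_add] at h
  exact (pow_left_inj₀ dist_nonneg dist_nonneg two_ne_zero).mp h

/-- The horizontal embedding `a ↦ (a, b)` is an isometry. [folklore] -/
theorem isometry_toLp_left (b : β) : Isometry (fun a : α ↦ toLp 2 (a, b)) :=
  Isometry.of_dist_eq fun a a' ↦ prodL2_dist_toLp_left a a' b

/-- The vertical embedding `b ↦ (a, b)` is an isometry. [folklore] -/
theorem isometry_toLp_right (a : α) : Isometry (fun b : β ↦ toLp 2 (a, b)) :=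
  Isometry.of_dist_eq fun b b' ↦ prodL2_dist_toLp_right a b b'

end DistSq

/-! ### §2. Lines in a product with a bounded factor are horizontal -/

section Lines

variable {α β : Type*} [PseudoMetricSpace α] [PseudoMetricSpace β]

/-- LINES ARE HORIZONTAL. Let `γ : ℝ → α ×₂ β` be an isometric embedding of the real line into an
`ℓ²`-product whose second factor has diameter `≤ D`. Then the first components move at unit speed,
`d(γ(s)₁, γ(t)₁) = |s - t|`, and the second components do not move, `d(γ(s)₂, γ(t)₂) = 0`.
Proof: `a = d(γ(s)₁, γ(t)₁) ≤ L = |s - t|` always; if `s ≤ t` and `T > 0` then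
`d(γ(s-T)₁, γ(t+T)₁) ≤ T + a + T` by the triangle inequality and
`d(γ(s-T)₁, γ(t+T)₁)² = (L + 2T)² - d(γ(s-T)₂, γ(t+T)₂)² ≥ (L + 2T)² - D²`, whence
`4T(L - a) ≤ D² + a² - L² ≤ D²` for all `T > 0`, so `a = L`, and then `d(γ(s)₂, γ(t)₂)² = L² - a² = 0`.
(This is the bounded-factor case of "a line in `ℝᵏ × Y` with `Y` line-free is parallel to `ℝᵏ`".)
[folklore] -/
theorem dist_fst_eq_and_dist_snd_eq_zero_of_isometry {γ : ℝ → WithLp 2 (α × β)} (hγ : Isometry γ)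
    {D : ℝ} (hD : ∀ b b' : β, dist b b' ≤ D) (s t : ℝ) :
    dist (γ s).fst (γ t).fst = |s - t| ∧ dist (γ s).snd (γ t).snd = 0 := by
  have hd : ∀ p q : ℝ, dist (γ p) (γ q) = |p - q| := fun p q ↦ by rw [hγ.dist_eq, Real.dist_eq]
  have hfst : ∀ p q : ℝ, dist (γ p).fst (γ q).fst ≤ |p - q| := fun p q ↦
    (dist_fst_le _ _).trans_eq (hd p q)
  have hsq : ∀ p q : ℝ,
      dist (γ p).fst (γ q).fst ^ 2 + dist (γ p).snd (γ q).snd ^ 2 = (p - q) ^ 2 := fun p q ↦ by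
    rw [← prodL2_dist_sq, hd, sq_abs]
  suffices hge : |s - t| ≤ dist (γ s).fst (γ t).fst by
    have heq : dist (γ s).fst (γ t).fst = |s - t| := le_antisymm (hfst s t) hge
    refine ⟨heq, ?_⟩
    have h2 := hsq s t
    rw [heq, sq_abs] at h2
    have h3 : dist (γ s).snd (γ t).snd ^ 2 = 0 := by linarith
    exact pow_eq_zero_iff two_ne_zero |>.mp h3
  wlog hst : s ≤ t generalizing s t
  · have h := this t s (le_of_not_ge hst)
    rwa [abs_sub_comm, dist_comm] at h
  have hL : |s - t| = t - s := by
    rw [abs_sub_comm]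
    exact abs_of_nonneg (sub_nonneg.mpr hst)
  rw [hL]
  set a := dist (γ s).fst (γ t).fst with ha_def
  have ha0 : 0 ≤ a := dist_nonneg
  have haL : a ≤ t - s := hL ▸ hfst s t
  -- the key estimate: for every `T > 0`, `4 T ((t - s) - a) ≤ D ^ 2`
  have key : ∀ T : ℝ, 0 < T → 4 * T * ((t - s) - a) ≤ D ^ 2 := by
    intro T hT
    have h1 : dist (γ (s - T)).fst (γ (t + T)).fst ≤ a + 2 * T := by
      have e1 : dist (γ (s - T)).fst (γ s).fst ≤ T := by
        refine (hfst _ _).trans_eq ?_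
        rw [show s - T - s = -T by ring, abs_neg, abs_of_pos hT]
      have e2 : dist (γ t).fst (γ (t + T)).fst ≤ T := by
        refine (hfst _ _).trans_eq ?_
        rw [show t - (t + T) = -T by ring, abs_neg, abs_of_pos hT]
      linarith [dist_triangle4 (γ (s - T)).fst (γ s).fst (γ t).fst (γ (t + T)).fst]
    have h2 : (t - s + 2 * T) ^ 2 - D ^ 2 ≤ dist (γ (s - T)).fst (γ (t + T)).fst ^ 2 := by
      have e3 := hsq (s - T) (t + T)
      have e4 : dist (γ (s - T)).snd (γ (t + T)).snd ^ 2 ≤ D ^ 2 :=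
        pow_le_pow_left₀ dist_nonneg (hD _ _) 2
      have e5 : (s - T - (t + T)) ^ 2 = (t - s + 2 * T) ^ 2 := by ring
      linarith
    have h3 : dist (γ (s - T)).fst (γ (t + T)).fst ^ 2 ≤ (a + 2 * T) ^ 2 :=
      pow_le_pow_left₀ dist_nonneg h1 2
    have h4 : a ^ 2 ≤ (t - s) ^ 2 := pow_le_pow_left₀ ha0 haL 2
    nlinarith [h2, h3, h4]
  by_contra hle
  have hlt : a < t - s := lt_of_not_ge hle
  have hpos : 0 < (t - s) - a := sub_pos.mpr hlt
  have h5 := key ((D ^ 2 + 1) / (4 * ((t - s) - a))) (by positivity)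
  have h6 : 4 * ((D ^ 2 + 1) / (4 * ((t - s) - a))) * ((t - s) - a) = D ^ 2 + 1 := by
    field_simp
  linarith

/-- The first component of a line in `α ×₂ β` (`β` of bounded diameter) is itself an isometric
embedding `ℝ → α`. [folklore] -/
theorem isometry_fst_comp_of_isometry {γ : ℝ → WithLp 2 (α × β)} (hγ : Isometry γ)
    {D : ℝ} (hD : ∀ b b' : β, dist b b' ≤ D) : Isometry (fun t ↦ (γ t).fst) :=
  Isometry.of_dist_eq fun s t ↦ by
    rw [(dist_fst_eq_and_dist_snd_eq_zero_of_isometry hγ hD s t).1, Real.dist_eq]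

/-- The second component of a line in `α ×₂ Y` (`Y` a METRIC space of bounded diameter) is
constant. [folklore] -/
theorem snd_apply_eq_of_isometry {Y : Type*} [MetricSpace Y] {γ : ℝ → WithLp 2 (α × Y)}
    (hγ : Isometry γ) {D : ℝ} (hD : ∀ y y' : Y, dist y y' ≤ D) (s t : ℝ) :
    (γ s).snd = (γ t).snd :=
  dist_eq_zero.mp (dist_fst_eq_and_dist_snd_eq_zero_of_isometry hγ hD s t).2

end Lines

/-! ### §3. Isometries into a product with a bounded factor respect horizontal slices -/

section Horizontal

variable {E : Type*} [NormedAddCommGroup E] [NormedSpace ℝ E] {β : Type*} [PseudoMetricSpace β]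

/-- The horizontal line `t ↦ (v + t • u, b)` through `(v, b)` in a unit direction `u` is an
isometric embedding `ℝ → E ×₂ β`. [folklore] -/
theorem isometry_lineMap_toLp (v u : E) (hu : ‖u‖ = 1) (b : β) :
    Isometry (fun t : ℝ ↦ toLp 2 (v + t • u, b)) := by
  refine Isometry.of_dist_eq fun s t ↦ ?_
  rw [prodL2_dist_toLp_left, dist_eq_norm, add_sub_add_left_eq_sub, ← sub_smul, norm_smul, hu,
    mul_one, Real.norm_eq_abs, Real.dist_eq]

/-- An isometric map from `E ×₂ β` (`E` a real normed space) into a product `α' ×₂ Y'` whose second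
factor is a bounded METRIC space sends each horizontal slice `E × {b}` into a horizontal slice: the
second component of `h (v, b)` does not depend on `v`. (Join `v` to `v'` by a line; its image is a
line, which is horizontal by §2.) [folklore] -/
theorem snd_apply_toLp_eq_of_isometry {α' Y' : Type*} [PseudoMetricSpace α'] [MetricSpace Y']
    [BoundedSpace Y'] {h : WithLp 2 (E × β) → WithLp 2 (α' × Y')} (hh : Isometry h)
    (v v' : E) (b : β) : (h (toLp 2 (v, b))).snd = (h (toLp 2 (v', b))).snd := by
  obtain ⟨D, hD⟩ := Metric.boundedSpace_iff.mp ‹BoundedSpace Y'›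
  by_cases hv : v' = v
  · rw [hv]
  · have hr : 0 < ‖v' - v‖ := norm_pos_iff.mpr (sub_ne_zero.mpr hv)
    set u := ‖v' - v‖⁻¹ • (v' - v) with hu_def
    have hu : ‖u‖ = 1 := by
      rw [hu_def, norm_smul, norm_inv, norm_norm, inv_mul_cancel₀ hr.ne']
    have hγ := hh.comp (isometry_lineMap_toLp v u hu b)
    have h0 := snd_apply_eq_of_isometry hγ hD 0 ‖v' - v‖
    simp only [Function.comp_apply, zero_smul, add_zero] at h0
    rw [h0, hu_def, smul_smul, mul_inv_cancel₀ hr.ne', one_smul, add_sub_cancel]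

end Horizontal

/-! ### §4. Isometric equivalences of products with bounded factors split -/

section Splitting

variable {E E' : Type*} [NormedAddCommGroup E] [NormedSpace ℝ E] [NormedAddCommGroup E']
  {Y Y' : Type*} [MetricSpace Y] [MetricSpace Y'] [BoundedSpace Y']

/-- The second component `B_h : Y → Y'` of an isometric equivalence `h : E ×₂ Y ≃ᵢ E' ×₂ Y'`
(read off on the slice `{0} × Y`; by `snd_apply_toLp_eq_of_isometry` any slice gives the same map).
[folklore] -/
def sndPart (h : WithLp 2 (E × Y) ≃ᵢ WithLp 2 (E' × Y')) (y : Y) : Y' :=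
  (h (toLp 2 (0, y))).snd

/-- `(h (v, y))₂ = B_h y` for every `v`. [folklore] -/
theorem snd_apply_toLp (h : WithLp 2 (E × Y) ≃ᵢ WithLp 2 (E' × Y')) (v : E) (y : Y) :
    (h (toLp 2 (v, y))).snd = sndPart h y :=
  snd_apply_toLp_eq_of_isometry h.isometry v 0 y

/-- PYTHAGORAS TRANSPORTED: `d((h(v,y))₁, (h(v',y'))₁)² + d(B_h y, B_h y')² = d(v,v')² + d(y,y')²`.
[folklore] -/
theorem dist_fst_sq_add_dist_sndPart_sq (h : WithLp 2 (E × Y) ≃ᵢ WithLp 2 (E' × Y')) (v v' : E)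
    (y y' : Y) :
    dist (h (toLp 2 (v, y))).fst (h (toLp 2 (v', y'))).fst ^ 2 +
        dist (sndPart h y) (sndPart h y') ^ 2 = dist v v' ^ 2 + dist y y' ^ 2 := by
  rw [← snd_apply_toLp h v y, ← snd_apply_toLp h v' y', ← prodL2_dist_sq, h.dist_eq,
    prodL2_dist_toLp_sq]

/-- `B_h` does not increase distances. [folklore] -/
theorem dist_sndPart_le (h : WithLp 2 (E × Y) ≃ᵢ WithLp 2 (E' × Y')) (y y' : Y) :
    dist (sndPart h y) (sndPart h y') ≤ dist y y' := by
  have h1 := dist_fst_sq_add_dist_sndPart_sq h 0 0 y y'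
  rw [dist_self, zero_pow two_ne_zero, zero_add] at h1
  have h2 : dist (sndPart h y) (sndPart h y') ^ 2 ≤ dist y y' ^ 2 := by
    nlinarith [sq_nonneg (dist (h (toLp 2 (0, y))).fst (h (toLp 2 (0, y'))).fst)]
  exact (pow_le_pow_iff_left₀ dist_nonneg dist_nonneg two_ne_zero).mp h2

/-- On a fixed slice the first component is distance-preserving:
`d((h(v,y))₁, (h(v',y))₁) = d(v, v')`. [folklore] -/
theorem dist_fst_apply_toLp (h : WithLp 2 (E × Y) ≃ᵢ WithLp 2 (E' × Y')) (v v' : E) (y : Y) :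
    dist (h (toLp 2 (v, y))).fst (h (toLp 2 (v', y))).fst = dist v v' := by
  have h1 := dist_fst_sq_add_dist_sndPart_sq h v v' y y
  rw [dist_self, dist_self, zero_pow two_ne_zero, add_zero, add_zero] at h1
  exact (pow_left_inj₀ dist_nonneg dist_nonneg two_ne_zero).mp h1

variable [NormedSpace ℝ E'] [BoundedSpace Y]

/-- `B_{h⁻¹} ∘ B_h = id`. [folklore] -/
theorem sndPart_symm_apply_sndPart (h : WithLp 2 (E × Y) ≃ᵢ WithLp 2 (E' × Y')) (y : Y) :
    sndPart h.symm (sndPart h y) = y := by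
  have h1 : h.symm (h (toLp 2 (0, y))) = toLp 2 (0, y) := h.symm_apply_apply _
  rw [← toLp_fst_snd (h (toLp 2 (0, y))), snd_apply_toLp h 0 y] at h1
  have h2 := congr_arg WithLp.snd h1
  rwa [snd_apply_toLp h.symm, toLp_snd] at h2

/-- `B_h ∘ B_{h⁻¹} = id`. [folklore] -/
theorem sndPart_apply_sndPart_symm (h : WithLp 2 (E × Y) ≃ᵢ WithLp 2 (E' × Y')) (y' : Y') :
    sndPart h (sndPart h.symm y') = y' := by
  simpa only [IsometryEquiv.symm_symm] using sndPart_symm_apply_sndPart h.symm y'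

/-- `B_h` is distance-preserving: it and `B_{h⁻¹}` are mutually inverse and both
distance-non-increasing. [folklore] -/
theorem dist_sndPart (h : WithLp 2 (E × Y) ≃ᵢ WithLp 2 (E' × Y')) (y y' : Y) :
    dist (sndPart h y) (sndPart h y') = dist y y' := by
  refine le_antisymm (dist_sndPart_le h y y') ?_
  have h1 := dist_sndPart_le h.symm (sndPart h y) (sndPart h y')
  rwa [sndPart_symm_apply_sndPart, sndPart_symm_apply_sndPart] at h1

/-- THE SECOND COMPONENT `Π₂(h) = B_h : Y ≃ᵢ Y'` of an isometric equivalence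
`h : E ×₂ Y ≃ᵢ E' ×₂ Y'` of `ℓ²`-products of real normed spaces with bounded metric spaces.
[cite: HuangHuangWangZhu2026, §4 p. 13 ("H acts separately on the two factors"; Π₂)] -/
def sndComponent (h : WithLp 2 (E × Y) ≃ᵢ WithLp 2 (E' × Y')) : Y ≃ᵢ Y' where
  toFun := sndPart h
  invFun := sndPart h.symm
  left_inv := sndPart_symm_apply_sndPart h
  right_inv := sndPart_apply_sndPart_symm h
  isometry_toFun := Isometry.of_dist_eq (dist_sndPart h)

/-- Unfolding lemma for `sndComponent`. [folklore] -/
theorem sndComponent_apply (h : WithLp 2 (E × Y) ≃ᵢ WithLp 2 (E' × Y')) (y : Y) :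
    sndComponent h y = (h (toLp 2 (0, y))).snd :=
  rfl

/-- `(h (v, y))₂ = Π₂(h) y`. [folklore] -/
theorem snd_apply_toLp_eq_sndComponent (h : WithLp 2 (E × Y) ≃ᵢ WithLp 2 (E' × Y')) (v : E)
    (y : Y) : (h (toLp 2 (v, y))).snd = sndComponent h y :=
  snd_apply_toLp h v y

/-- The first component of `h (v, y)` does not depend on `y`: by Pythagoras transported,
`d((h(v,y))₁, (h(v,y'))₁)² = d(y,y')² - d(B_h y, B_h y')² = 0`. [folklore] -/
theorem fst_apply_toLp_eq (h : WithLp 2 (E × Y) ≃ᵢ WithLp 2 (E' × Y')) (v : E) (y y' : Y) :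
    (h (toLp 2 (v, y))).fst = (h (toLp 2 (v, y'))).fst := by
  have h1 := dist_fst_sq_add_dist_sndPart_sq h v v y y'
  rw [dist_sndPart, dist_self, zero_pow two_ne_zero, zero_add, add_eq_right] at h1
  exact dist_eq_zero.mp (pow_eq_zero_iff two_ne_zero |>.mp h1)

variable [Nonempty Y]

/-- The first component `A_h : E → E'` of an isometric equivalence `h : E ×₂ Y ≃ᵢ E' ×₂ Y'`, read
off on any slice `E × {y₀}` (independent of `y₀` by `fst_apply_toLp_eq`; `Y` is assumed nonempty).
[folklore] -/
def fstPart (h : WithLp 2 (E × Y) ≃ᵢ WithLp 2 (E' × Y')) (v : E) : E' :=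
  (h (toLp 2 (v, Classical.arbitrary Y))).fst

/-- `(h (v, y))₁ = A_h v` for every `y`. [folklore] -/
theorem fst_apply_toLp (h : WithLp 2 (E × Y) ≃ᵢ WithLp 2 (E' × Y')) (v : E) (y : Y) :
    (h (toLp 2 (v, y))).fst = fstPart h v :=
  fst_apply_toLp_eq h v y _

/-- SPLITTING, pointwise form: `h (v, y) = (A_h v, B_h y)`. [folklore] -/
theorem apply_toLp_eq_toLp_fstPart_sndPart (h : WithLp 2 (E × Y) ≃ᵢ WithLp 2 (E' × Y')) (v : E)
    (y : Y) : h (toLp 2 (v, y)) = toLp 2 (fstPart h v, sndPart h y) := by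
  rw [← fst_apply_toLp h v y, ← snd_apply_toLp h v y, toLp_fst_snd]

omit [NormedSpace ℝ E'] [BoundedSpace Y] in
/-- `A_h` is distance-preserving. [folklore] -/
theorem dist_fstPart (h : WithLp 2 (E × Y) ≃ᵢ WithLp 2 (E' × Y')) (v v' : E) :
    dist (fstPart h v) (fstPart h v') = dist v v' :=
  dist_fst_apply_toLp h v v' _

variable [Nonempty Y']

/-- `A_{h⁻¹} ∘ A_h = id`. [folklore] -/
theorem fstPart_symm_apply_fstPart (h : WithLp 2 (E × Y) ≃ᵢ WithLp 2 (E' × Y')) (v : E) :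
    fstPart h.symm (fstPart h v) = v := by
  obtain ⟨y⟩ := ‹Nonempty Y›
  have h1 : h.symm (h (toLp 2 (v, y))) = toLp 2 (v, y) := h.symm_apply_apply _
  rw [apply_toLp_eq_toLp_fstPart_sndPart h v y] at h1
  have h2 := congr_arg WithLp.fst h1
  rwa [fst_apply_toLp h.symm, toLp_fst] at h2

/-- `A_h ∘ A_{h⁻¹} = id`. [folklore] -/
theorem fstPart_apply_fstPart_symm (h : WithLp 2 (E × Y) ≃ᵢ WithLp 2 (E' × Y')) (v' : E') :
    fstPart h (fstPart h.symm v') = v' := by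
  simpa only [IsometryEquiv.symm_symm] using fstPart_symm_apply_fstPart h.symm v'

/-- THE FIRST COMPONENT `Π₁(h) = A_h : E ≃ᵢ E'` of an isometric equivalence
`h : E ×₂ Y ≃ᵢ E' ×₂ Y'` of `ℓ²`-products of real normed spaces with nonempty bounded metric spaces.
[cite: HuangHuangWangZhu2026, §4 p. 13 ("H acts separately on the two factors"; Π₁)] -/
def fstComponent (h : WithLp 2 (E × Y) ≃ᵢ WithLp 2 (E' × Y')) : E ≃ᵢ E' where
  toFun := fstPart h
  invFun := fstPart h.symm
  left_inv := fstPart_symm_apply_fstPart h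
  right_inv := fstPart_apply_fstPart_symm h
  isometry_toFun := Isometry.of_dist_eq (dist_fstPart h)

/-- `(h (v, y))₁ = Π₁(h) v`. [folklore] -/
theorem fst_apply_toLp_eq_fstComponent (h : WithLp 2 (E × Y) ≃ᵢ WithLp 2 (E' × Y')) (v : E)
    (y : Y) : (h (toLp 2 (v, y))).fst = fstComponent h v :=
  fst_apply_toLp h v y

/-- ISOMETRIES OF A PRODUCT WITH A BOUNDED FACTOR SPLIT (Huang–Huang–Wang–Zhu 2026, §4 p. 13:
"each `h` has the form `(h₁, h₂)`, `h₁ ∈ Isom(ℝˢ)`, `h₂ ∈ Isom(Ŷ)`", for compact — here merely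
bounded — `Ŷ`): every isometric equivalence `h : E ×₂ Y ≃ᵢ E' ×₂ Y'` between `ℓ²`-products of real
normed spaces with nonempty bounded metric spaces is the product of its components,
`h (v, y) = (Π₁(h) v, Π₂(h) y)`.
[cite: HuangHuangWangZhu2026, §4 p. 13] -/
theorem apply_toLp (h : WithLp 2 (E × Y) ≃ᵢ WithLp 2 (E' × Y')) (v : E) (y : Y) :
    h (toLp 2 (v, y)) = toLp 2 (fstComponent h v, sndComponent h y) :=
  apply_toLp_eq_toLp_fstPart_sndPart h v y

/-- Coordinate-free form of the splitting: `h x = (Π₁(h) x₁, Π₂(h) x₂)`. [folklore] -/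
theorem apply_eq_toLp (h : WithLp 2 (E × Y) ≃ᵢ WithLp 2 (E' × Y')) (x : WithLp 2 (E × Y)) :
    h x = toLp 2 (fstComponent h x.fst, sndComponent h x.snd) := by
  rw [← apply_toLp, toLp_fst_snd]

end Splitting

/-! ### §5. The projections `Π₁`, `Π₂` are homomorphisms; `Isom(E ×₂ Y) ≅ Isom(E) × Isom(Y)` -/

section ProdCongr

variable {α α' β β' : Type*} [PseudoMetricSpace α] [PseudoMetricSpace α'] [PseudoMetricSpace β]
  [PseudoMetricSpace β']

/-- The product `A × B : α ×₂ β ≃ᵢ α' ×₂ β'` of two isometric equivalences (for the `ℓ²`-product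
metric). [folklore] -/
def prodCongrL2 (A : α ≃ᵢ α') (B : β ≃ᵢ β') : WithLp 2 (α × β) ≃ᵢ WithLp 2 (α' × β') where
  toFun x := toLp 2 (A x.fst, B x.snd)
  invFun x := toLp 2 (A.symm x.fst, B.symm x.snd)
  left_inv x := by simp [toLp_fst_snd]
  right_inv x := by simp [toLp_fst_snd]
  isometry_toFun := Isometry.of_dist_eq fun x x' ↦ by
    have h1 := prodL2_dist_toLp_sq (A x.fst) (A x'.fst) (B x.snd) (B x'.snd)
    rw [A.dist_eq, B.dist_eq, ← prodL2_dist_sq] at h1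
    exact (pow_left_inj₀ dist_nonneg dist_nonneg two_ne_zero).mp h1

/-- Unfolding lemma for `prodCongrL2`. [folklore] -/
theorem prodCongrL2_apply (A : α ≃ᵢ α') (B : β ≃ᵢ β') (x : WithLp 2 (α × β)) :
    prodCongrL2 A B x = toLp 2 (A x.fst, B x.snd) :=
  rfl

/-- `prodCongrL2` on explicit pairs. [folklore] -/
theorem prodCongrL2_toLp (A : α ≃ᵢ α') (B : β ≃ᵢ β') (a : α) (b : β) :
    prodCongrL2 A B (toLp 2 (a, b)) = toLp 2 (A a, B b) :=
  rfl

end ProdCongr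

section Homs

variable {E : Type*} [NormedAddCommGroup E] [NormedSpace ℝ E] {Y : Type*} [MetricSpace Y]
  [BoundedSpace Y] [Nonempty Y]

/-- An isometry of `E ×₂ Y` is determined by its two components. [folklore] -/
theorem eq_prodCongrL2 (h : WithLp 2 (E × Y) ≃ᵢ WithLp 2 (E × Y)) :
    h = prodCongrL2 (fstComponent h) (sndComponent h) :=
  IsometryEquiv.ext fun x ↦ by rw [apply_eq_toLp, prodCongrL2_apply]

/-- The components of a product isometry `A × B` are `A` and `B` (first). [folklore] -/
theorem fstComponent_prodCongrL2 (A : E ≃ᵢ E) (B : Y ≃ᵢ Y) :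
    fstComponent (prodCongrL2 A B) = A :=
  IsometryEquiv.ext fun v ↦ by
    obtain ⟨y⟩ := ‹Nonempty Y›
    rw [← fst_apply_toLp_eq_fstComponent _ v y, prodCongrL2_toLp, toLp_fst]

omit [Nonempty Y] in
/-- The components of a product isometry `A × B` are `A` and `B` (second). [folklore] -/
theorem sndComponent_prodCongrL2 (A : E ≃ᵢ E) (B : Y ≃ᵢ Y) :
    sndComponent (prodCongrL2 A B) = B :=
  IsometryEquiv.ext fun y ↦ by
    rw [← snd_apply_toLp_eq_sndComponent _ (0 : E) y, prodCongrL2_toLp, toLp_snd]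

/-- `Π₁ : Isom(E ×₂ Y) →* Isom(E)`, the projection homomorphism of Huang–Huang–Wang–Zhu 2026,
§4 p. 13 (there for `ℝˢ × Ŷ`; `G = Im Π₁`, `N₀ = ker Π₁`). [cite: HuangHuangWangZhu2026, §4 p. 13] -/
def fstComponentHom : (WithLp 2 (E × Y) ≃ᵢ WithLp 2 (E × Y)) →* (E ≃ᵢ E) where
  toFun := fstComponent
  map_one' := IsometryEquiv.ext fun v ↦ by
    obtain ⟨y⟩ := ‹Nonempty Y›
    rw [← fst_apply_toLp_eq_fstComponent _ v y, IsometryEquiv.coe_one, id, toLp_fst,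
      IsometryEquiv.coe_one, id]
  map_mul' h₁ h₂ := IsometryEquiv.ext fun v ↦ by
    obtain ⟨y⟩ := ‹Nonempty Y›
    rw [← fst_apply_toLp_eq_fstComponent _ v y, IsometryEquiv.mul_apply, apply_toLp h₂,
      fst_apply_toLp_eq_fstComponent h₁, IsometryEquiv.mul_apply]

/-- `Π₂ : Isom(E ×₂ Y) →* Isom(Y)`, the second projection homomorphism.
[cite: HuangHuangWangZhu2026, §4 p. 13] -/
def sndComponentHom : (WithLp 2 (E × Y) ≃ᵢ WithLp 2 (E × Y)) →* (Y ≃ᵢ Y) where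
  toFun := sndComponent
  map_one' := IsometryEquiv.ext fun y ↦ by
    rw [← snd_apply_toLp_eq_sndComponent _ (0 : E) y, IsometryEquiv.coe_one, id, toLp_snd,
      IsometryEquiv.coe_one, id]
  map_mul' h₁ h₂ := IsometryEquiv.ext fun y ↦ by
    rw [← snd_apply_toLp_eq_sndComponent _ (0 : E) y, IsometryEquiv.mul_apply, apply_toLp h₂,
      snd_apply_toLp_eq_sndComponent h₁, IsometryEquiv.mul_apply]

/-- Unfolding lemma for `fstComponentHom`. [folklore] -/
theorem fstComponentHom_apply (h : WithLp 2 (E × Y) ≃ᵢ WithLp 2 (E × Y)) :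
    fstComponentHom h = fstComponent h :=
  rfl

/-- Unfolding lemma for `sndComponentHom`. [folklore] -/
theorem sndComponentHom_apply (h : WithLp 2 (E × Y) ≃ᵢ WithLp 2 (E × Y)) :
    sndComponentHom h = sndComponent h :=
  rfl

/-- `Isom(E ×₂ Y) ≅ Isom(E) × Isom(Y)`: the isomorphism `h ↦ (Π₁ h, Π₂ h)` with inverse
`(A, B) ↦ A × B`. In particular "`H` acts separately on the two factors" for every subgroup
`H ≤ Isom(E ×₂ Y)`. [cite: HuangHuangWangZhu2026, §4 p. 13] -/
def isometryEquivProdL2MulEquiv :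
    (WithLp 2 (E × Y) ≃ᵢ WithLp 2 (E × Y)) ≃* (E ≃ᵢ E) × (Y ≃ᵢ Y) where
  toFun h := (fstComponentHom h, sndComponentHom h)
  invFun AB := prodCongrL2 AB.1 AB.2
  left_inv h := (eq_prodCongrL2 h).symm
  right_inv AB := Prod.ext (fstComponent_prodCongrL2 AB.1 AB.2) (sndComponent_prodCongrL2 AB.1 AB.2)
  map_mul' h₁ h₂ := Prod.ext (map_mul fstComponentHom h₁ h₂) (map_mul sndComponentHom h₁ h₂)

end Homs


/-! ### §6. The projections of an `ℓ²`-product are submetries; the induced submetry of orbit spaces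

"There is a natural surjective map `F : X̄ → Tˢ` … `F(x̄)` is the projection of `π₁(x̂)` to
`Tˢ = ℝˢ/H₀`. Moreover, it is easy to see that `F` is a submetry at scale `1/4`."
(Huang–Huang–Wang–Zhu 2026, §4 p. 13.) Mechanism: the first projection `E ×₂ Y → E` is a submetry
(below) and is equivariant along `Π₁` for every subgroup `H₀ ≤ Isom(E ×₂ Y)` (§4–§5), so it
descends to a submetry of orbit spaces `(E ×₂ Y)/H₀ → E/H₀`
(`Literature.Geometry.MetricGeometry.IsSubmetry.descend`), at every scale; the actions involved
are the tautological one of `H₀ ≤ Isom(E ×₂ Y)` on `E ×₂ Y` (`Submetry.lean` §4) and the action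
on `E` through `Π₁` registered here. -/

section ProjSubmetry

variable {α β : Type*} [PseudoMetricSpace α] [PseudoMetricSpace β]

/-- The first projection of an `ℓ²`-product is a submetry: `fst (B_r(a, b)) = B_r(a)` (lift `a'` to
`(a', b)`, at the same distance by `prodL2_dist_toLp_left`). [folklore] -/
theorem isSubmetry_fst_L2 : IsSubmetry (WithLp.fst : WithLp 2 (α × β) → α) := by
  intro p r _
  apply Set.Subset.antisymm
  · rintro _ ⟨x, hx, rfl⟩
    exact Metric.mem_ball.mpr (lt_of_le_of_lt (dist_fst_le x p) (Metric.mem_ball.mp hx))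
  · intro a ha
    refine ⟨toLp 2 (a, p.snd), ?_, rfl⟩
    rw [Metric.mem_ball] at ha ⊢
    have h := prodL2_dist_toLp_left a p.fst p.snd
    rw [toLp_fst_snd] at h
    rwa [h]

/-- The second projection of an `ℓ²`-product is a submetry. [folklore] -/
theorem isSubmetry_snd_L2 : IsSubmetry (WithLp.snd : WithLp 2 (α × β) → β) := by
  intro p r _
  apply Set.Subset.antisymm
  · rintro _ ⟨x, hx, rfl⟩
    exact Metric.mem_ball.mpr (lt_of_le_of_lt (dist_snd_le x p) (Metric.mem_ball.mp hx))
  · intro b hb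
    refine ⟨toLp 2 (p.fst, b), ?_, rfl⟩
    rw [Metric.mem_ball] at hb ⊢
    have h := prodL2_dist_toLp_right p.fst b p.snd
    rw [toLp_fst_snd] at h
    rwa [h]

end ProjSubmetry

section OrbitSubmetry

variable {E : Type*} [NormedAddCommGroup E] [NormedSpace ℝ E] {Y : Type*} [MetricSpace Y]
  [BoundedSpace Y] [Nonempty Y]

/-- The action of `H₀` on the first factor through `Π₁`. [folklore] -/
instance mulActionFst (H₀ : Subgroup (WithLp 2 (E × Y) ≃ᵢ WithLp 2 (E × Y))) :
    MulAction H₀ E where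
  smul h v := fstComponentHom (h : WithLp 2 (E × Y) ≃ᵢ WithLp 2 (E × Y)) v
  one_smul v := by
    change fstComponentHom ((1 : H₀) : WithLp 2 (E × Y) ≃ᵢ WithLp 2 (E × Y)) v = v
    rw [OneMemClass.coe_one, map_one, IsometryEquiv.coe_one, id]
  mul_smul h h' v := by
    change fstComponentHom ((h * h' : H₀) : WithLp 2 (E × Y) ≃ᵢ WithLp 2 (E × Y)) v =
      fstComponentHom (h : WithLp 2 (E × Y) ≃ᵢ WithLp 2 (E × Y))
        (fstComponentHom (h' : WithLp 2 (E × Y) ≃ᵢ WithLp 2 (E × Y)) v)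
    rw [Subgroup.coe_mul, map_mul, IsometryEquiv.mul_apply]

/-- `h • v = Π₁(h) v`. [folklore] -/
theorem subgroup_smul_fst_def (H₀ : Subgroup (WithLp 2 (E × Y) ≃ᵢ WithLp 2 (E × Y))) (h : H₀)
    (v : E) : h • v = fstComponentHom (h : WithLp 2 (E × Y) ≃ᵢ WithLp 2 (E × Y)) v :=
  rfl

/-- The action through `Π₁` is isometric. [folklore] -/
instance isIsometricSMul_fst (H₀ : Subgroup (WithLp 2 (E × Y) ≃ᵢ WithLp 2 (E × Y))) :
    IsIsometricSMul H₀ E :=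
  ⟨fun h ↦ (fstComponentHom (h : WithLp 2 (E × Y) ≃ᵢ WithLp 2 (E × Y))).isometry⟩

/-- The first projection is `H₀`-equivariant along `Π₁`: `(h x)₁ = Π₁(h) x₁` (for the
tautological action of `H₀ ≤ Isom(E ×₂ Y)` on `E ×₂ Y`, `Subgroup.smul_def_isometryEquiv`, and
the action through `Π₁` on `E`). [folklore] -/
theorem fst_smul (H₀ : Subgroup (WithLp 2 (E × Y) ≃ᵢ WithLp 2 (E × Y))) (h : H₀)
    (x : WithLp 2 (E × Y)) : (h • x).fst = h • x.fst := by
  rw [Subgroup.smul_def_isometryEquiv, subgroup_smul_fst_def, apply_eq_toLp, toLp_fst,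
    fstComponentHom_apply]

/-- THE SUBMETRY `F : X̄ = (E ×₂ Y)/H₀ → E/Π₁(H₀)` (Huang–Huang–Wang–Zhu 2026, §4 p. 13: "`F` is a
submetry at scale `1/4`" for `X̄ = (ℝˢ × Ŷ)/H₀ → Tˢ = ℝˢ/G₀`, `G₀ = Π₁(H₀)`): the map of orbit spaces
induced by the first projection is a submetry at every scale, for every subgroup `H₀` of
`Isom(E ×₂ Y)` (`Y` nonempty bounded metric). [cite: HuangHuangWangZhu2026, §4 p. 13] -/
theorem isSubmetry_orbitQuotientMap_fst (H₀ : Subgroup (WithLp 2 (E × Y) ≃ᵢ WithLp 2 (E × Y))) :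
    IsSubmetry (orbitQuotientMap (G := H₀) (WithLp.fst : WithLp 2 (E × Y) → E) (fst_smul H₀)) :=
  isSubmetry_fst_L2.descend (fst_smul H₀)

end OrbitSubmetry

end Literature.Geometry.MetricGeometry

end
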